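import Summits.Ventures.CertifiedManyBodySolver.Observables.StiffnessThermalTorusLimitKinetic
import Summits.Ventures.CertifiedManyBodySolver.Observables.StiffnessTLKineticTTOrbitDictionary
import Literature.MathematicalPhysics.QuantumLattice.TorusSectorGibbsMixtureSymmetry
import HarnessLib

/-!
# ROUTE T-A‴ («coupling dilution») and ROUTE T-A″ (double occupancy) of the KT back-end, in the kernel:
# a thermal kinetic ceiling — hence `T_KT ≤ 1/β` — from ONE thermal ENERGY CAP at `(β, U)` and ONE
# ground-state energy FLOOR at a SMALLER coupling `U₁ < U` (or a thermal double-occupancy cap at `U`)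

HONEST FRAMING: a one-sided CEILING chain (energy coordinates ⇒ kinetic energy ⇒ stiffness ⇒ `T_KT`); not a
superconductivity verdict, not a `T_c` of any material, no number here. Cell `pub/hubbard-tc` (MO-S3 ORDER → T_c
back-end), seat `hubbard-tc-mod-2` (KT back-end; crux №3, HOME/hubbard-tc-mod-2/KT-THERMAL-INTERFACE.md §2d).

THE OBSERVATION. For every torus limit `ω` of the canonical `(rectN n L, S^z = 0)` Gibbs states of
`hubbardTorusTT' L 1 t′ U` at inverse temperature `β` write `K₁(ω), K₂(ω), D(ω)` for the nearest-neighbour hopping,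
unit-diagonal hopping and double-occupancy densities, so that `e_{Φ(1,t′,U')}(ω) = K₁ + t′K₂ + U'·D` at EVERY
coupling `U'` (`meanEnergy_hubbardTTPrime_eq_coords`). Two inputs,
* (CAP)   `e_{Φ(1,t′,U)}(ω) ≤ e^{up}` — a certified thermal ENERGY cap at `(β, U)` (the reader output of the
  free-energy route, `IsTorusLimitOfMixture.meanEnergy_hubbardTTPrime_le_of_markov_certificate`, or of any EEB row);
* (FLOOR) `e₁ ≤ e(1,t′,U₁,n)` — a certified GROUND-STATE energy floor at a smaller coupling `0 ≤ U₁ < U`, SAME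
  filling (any T = 0 certificate of record; it enters only through the number `e(1,t′,U₁,n)`),
give, by the variational inequality at the coupling `U₁` for the (thermal) state `ω`
(`IsTorusLimitOfMixture.energyDensityTT'_le_meanEnergy_add_slopes`: `e(1,t′,U₁,n) ≤ K₁ + t′K₂ + U₁·D`) and
elimination of `D`:
  `−(K₁(ω) + t′K₂(ω)) ≤ κ := (U₁·e^{up} − U·e₁)/(U − U₁)`      (Legendre dual of the energy cap).
Thermal torus limits are translation AND point-group invariant (`isD4Invariant_of_sectorGibbs`), so the
`x₁`-f-sum bond word reads `Re ω(k₀^{tt′}) = −½(K₁ + 2t′K₂)` (§1; the `D₄`-orbit dictionary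
`orbitMean_rotOddMomentLimitFunctionalTT_lam_zero` with every orbit term equal), hence
`Re ω(k₀) ≤ ½(κ + B)` for any cap `−t′K₂(ω) ≤ B` (`B = 0` at `t′ = 0`), which is exactly the hypothesis of
`ObsThermalStiffnessSeqCeilingAtBeta_of_torusLimit_kinetic_le` (p478720) with `2c ≥ ½(κ + B)`: the
single-temperature leaf, and `T_KT ≤ 1/β` as soon as `(π/4)·(κ + B)/4 < 1/β` (§3–§4). ROUTE T-A″ is the same with
the floor taken AT `U` and a thermal double-occupancy cap `D(ω) ≤ d^{up}`: `−(K₁ + t′K₂) ≤ U·d^{up} − e₁` (§2).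

No new definition, no named fact, no certificate, no numeral: everything is PROVED from landed interfaces.
SIZING (floats, KT-THERMAL-INTERFACE §2d): with today's cap `e(β·t = 4; 8, ⅞, 0) ≤ −0.474` a floor at `U₁ = 2`
within `0.02·t` of truth closes «`T_KT ≤ 0.31·t`» monotonicity-free once the cap is issued at `β·t ≤ 3.25`; the
route can never reach `t/4` (exact-input optimum `κ* ≈ 1.32 > 1.2732`).

WHAT THIS IS NOT: no certificate, no number, no `T_c`; pure glue between landed interfaces; not a claim that
the Hubbard model has a Kosterlitz–Thouless transition.

References: HazraVermaRanderia2019 eqs. (2)–(4); ScalapinoWhiteZhang1993 §II; Ruelle1969 §3.4 (the energy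
density is the infimum of the mean energy over invariant states); BratteliRobinsonI1987 §4.3.1; KomaTasaki1994 §1.
-/

noncomputable section

namespace Summit.Ventures.CertifiedManyBodySolver.Observables

open Filter Topology Matrix Finset
open Literature.MathematicalPhysics.QuantumLattice
open Literature.MathematicalPhysics.QuantumLattice.InfVolFermionState
open Literature.MathematicalPhysics.QuantumLattice.ThermodynamicLimit
open Literature.MathematicalPhysics.QuantumFieldTheory
open Literature.MathematicalPhysics.StatisticalMechanics
open Literature.MathematicalPhysics.StatisticalMechanics.KosterlitzThouless
open Literature.Probability.LatticeModels
open scoped ComplexConjugate ComplexOrder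

/-! ### §1 The `x₁`-f-sum bond word of a translation- and point-group-invariant state, in energy coordinates -/

/-- **`Re ω(k₀^{tt′}) = −½·(K₁(ω) + 2t′·K₂(ω))` for every translation- and `D₄`-invariant `ω`.** Every term of
the `D₄`-orbit sum of `orbitMean_rotOddMomentLimitFunctionalTT_lam_zero` equals `Re ω_{Λ₇}(X₀) = ½Re ω(k₀)`
(`IsD4Invariant.expect_fermionEmbed_d4Emb`, `re_expect_oddMomentObsTT_lam_zero`), so the orbit mean is `½Re ω(k₀)`.
[cite: HazraVermaRanderia2019, eq. (4)] [cite: BratteliRobinsonI1987, §4.3.1] -/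
theorem re_expect_kinBondObsTT_eq_of_isD4Invariant {ω : InfVolFermionState 2} (hω : ω.IsTranslationInvariant)
    (hD : ω.IsD4Invariant) (tp : ℝ) :
    (ω.expect (box 2 1) (kinBondObsTT tp)).re =
      -(1 / 2) * (ω.meanEnergy (hubbardTTPrimeFermionInteraction 1 0 0) 1 +
        2 * tp * ω.meanEnergy (hubbardTTPrimeFermionInteraction 0 1 0) 1) := by
  have h := orbitMean_rotOddMomentLimitFunctionalTT_lam_zero hω tp 0
  have hterm : ∀ γ : DihedralGroup 4,
      rotOddMomentLimitFunctionalTT tp 0 0 γ ω = (1 / 2) * (ω.expect (box 2 1) (kinBondObsTT tp)).re := by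
    intro γ
    unfold rotOddMomentLimitFunctionalTT
    rw [hD.expect_fermionEmbed_d4Emb, re_expect_oddMomentObsTT_lam_zero]
  have hcard : ((Finset.univ : Finset (DihedralGroup 4)).card : ℝ) = 8 := by
    rw [Finset.card_univ]; exact_mod_cast (by decide : Fintype.card (DihedralGroup 4) = 8)
  simp_rw [hterm, Finset.sum_const, nsmul_eq_mul, hcard] at h
  linarith

/-! ### §2 The dilution inequality (ROUTE T-A‴) and the double-occupancy inequality (ROUTE T-A″) -/

/-- **Coupling dilution, state by state.** `U ≥ 0`, `0 ≤ n < 2`, `0 ≤ U₁ < U`. For a torus limit `ω` of the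
canonical sector Gibbs states of `hubbardTorusTT' L 1 t′ U` at `β` (any `β`): a cap `e_{Φ(1,t′,U)}(ω) ≤ e^{up}`, a
floor `e₁ ≤ e(1,t′,U₁,n)` and a cap `−t′·K₂(ω) ≤ B` give
`Re ω(k₀^{tt′}) ≤ ½·((U₁·e^{up} − U·e₁)/(U − U₁) + B)`. Proof: the variational inequality at `U₁`
(`energyDensityTT'_le_meanEnergy_add_slopes`), `e_Φ = K₁ + t′K₂ + U·D` (`meanEnergy_hubbardTTPrime_eq_coords`,
`meanEnergy_onSite_eq_re_expect_docc`), elimination of `D`, and §1 (`isD4Invariant_of_sectorGibbs`).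
[cite: Ruelle1969, §3.4] [cite: HazraVermaRanderia2019, eq. (4)] -/
theorem re_expect_kinBondObsTT_le_of_energyCap_of_gsFloor {tp U n β : ℝ} (hU : 0 ≤ U) (hn0 : 0 ≤ n)
    (hn2 : n < 2) {U₁ e₁ eup B : ℝ} (hU₁ : 0 ≤ U₁) (hU₁U : U₁ < U)
    (hfloor : e₁ ≤ energyDensityTT' 1 tp U₁ n)
    {ω : InfVolFermionState 2} {Ls : ℕ → ℕ}
    (h : ω.IsTorusLimitOfMixture (sectorGibbsCount n) (fun L => sectorGibbsWeightTT' β 1 tp U n L)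
      (fun L => sectorGibbsVectorTT' 1 tp U n L) Ls) (hLs : Tendsto Ls atTop atTop)
    (hcap : ω.meanEnergy (hubbardTTPrimeFermionInteraction 1 tp U) 1 ≤ eup)
    (hB : -tp * ω.meanEnergy (hubbardTTPrimeFermionInteraction 0 1 0) 1 ≤ B) :
    (ω.expect (box 2 1) (kinBondObsTT tp)).re ≤ ((U₁ * eup - U * e₁) / (U - U₁) + B) / 2 := by
  have hvar := h.energyDensityTT'_le_meanEnergy_add_slopes 1 tp U hn0 hn2 hLs
    (fun L i => sectorGibbsWeightTT'_nonneg β 1 tp U n L i)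
    (fun L => sum_sectorGibbsWeightTT' β 1 tp U hn0 hn2.le L)
    (fun L i => isNParticle_sectorGibbsVectorTT' 1 tp U n L i)
    (fun L i => star_sectorGibbsVectorTT'_dotProduct_self 1 tp U n L i) tp hU₁
  rw [← h.meanEnergy_onSite_eq_re_expect_docc hLs, sub_self, zero_mul, add_zero] at hvar
  have hco := InfVolFermionState.meanEnergy_hubbardTTPrime_eq_coords ω 1 tp U
  rw [re_expect_kinBondObsTT_eq_of_isD4Invariant h.isTranslationInvariant
    (h.isD4Invariant_of_sectorGibbs 1 tp U n β hLs) tp]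
  set E := ω.meanEnergy (hubbardTTPrimeFermionInteraction 1 tp U) 1 with hE
  set K₁ := ω.meanEnergy (hubbardTTPrimeFermionInteraction 1 0 0) 1 with hK₁
  set K₂ := ω.meanEnergy (hubbardTTPrimeFermionInteraction 0 1 0) 1 with hK₂
  set D := ω.meanEnergy (hubbardTTPrimeFermionInteraction 0 0 1) 1 with hD
  have hpos : 0 < U - U₁ := sub_pos.2 hU₁U
  -- `(U − U₁)(K₁ + t′K₂) ≥ U·e₁ − U₁·e^{up}`
  have h1 : U * e₁ ≤ U * (K₁ + tp * K₂ + U₁ * D) := by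
    refine mul_le_mul_of_nonneg_left (hfloor.trans ?_) hU
    rw [hco] at hvar; linarith
  have h2 : U₁ * (K₁ + tp * K₂ + U * D) ≤ U₁ * eup := by
    refine mul_le_mul_of_nonneg_left ?_ hU₁
    rw [hco] at hcap; linarith
  have hκ : -(K₁ + tp * K₂) ≤ (U₁ * eup - U * e₁) / (U - U₁) := by
    rw [le_div_iff₀ hpos]; nlinarith
  linarith

/-- **Double-occupancy form (ROUTE T-A″), state by state.** `U ≥ 0`, `0 ≤ n < 2`. For a torus limit `ω` of
the canonical sector Gibbs states of `hubbardTorusTT' L 1 t′ U` at `β`: a thermal double-occupancy cap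
`D(ω) ≤ d^{up}`, a ground-state floor `e₁ ≤ e(1,t′,U,n)` AT the coupling `U` and a cap `−t′·K₂(ω) ≤ B` give
`Re ω(k₀^{tt′}) ≤ ½·(U·d^{up} − e₁ + B)` (`−(K₁ + t′K₂) = U·D − e_Φ ≤ U·d^{up} − e₁`, variational inequality at `U`).
[cite: Ruelle1969, §3.4] [cite: HazraVermaRanderia2019, eq. (4)] -/
theorem re_expect_kinBondObsTT_le_of_doccCap_of_gsFloor {tp U n β : ℝ} (hU : 0 ≤ U) (hn0 : 0 ≤ n)
    (hn2 : n < 2) {e₁ dup B : ℝ} (hfloor : e₁ ≤ energyDensityTT' 1 tp U n)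
    {ω : InfVolFermionState 2} {Ls : ℕ → ℕ}
    (h : ω.IsTorusLimitOfMixture (sectorGibbsCount n) (fun L => sectorGibbsWeightTT' β 1 tp U n L)
      (fun L => sectorGibbsVectorTT' 1 tp U n L) Ls) (hLs : Tendsto Ls atTop atTop)
    (hdocc : ω.meanEnergy (hubbardTTPrimeFermionInteraction 0 0 1) 1 ≤ dup)
    (hB : -tp * ω.meanEnergy (hubbardTTPrimeFermionInteraction 0 1 0) 1 ≤ B) :
    (ω.expect (box 2 1) (kinBondObsTT tp)).re ≤ (U * dup - e₁ + B) / 2 := by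
  have hvar := h.energyDensityTT'_le_meanEnergy_hubbardTTPrime 1 tp hU hn0 hn2 hLs
    (fun L i => sectorGibbsWeightTT'_nonneg β 1 tp U n L i)
    (fun L => sum_sectorGibbsWeightTT' β 1 tp U hn0 hn2.le L)
    (fun L i => isNParticle_sectorGibbsVectorTT' 1 tp U n L i)
    (fun L i => star_sectorGibbsVectorTT'_dotProduct_self 1 tp U n L i)
  have hco := InfVolFermionState.meanEnergy_hubbardTTPrime_eq_coords ω 1 tp U
  rw [re_expect_kinBondObsTT_eq_of_isD4Invariant h.isTranslationInvariant
    (h.isD4Invariant_of_sectorGibbs 1 tp U n β hLs) tp]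
  have hUd := mul_le_mul_of_nonneg_left hdocc hU
  rw [hco] at hvar
  linarith

/-! ### §3 The single-temperature stiffness leaf from (CAP) + (FLOOR) -/

/-- **ROUTE T-A‴ ⇒ the single-temperature leaf.** `0 < β`, `U ≥ 0`, `0 ≤ n < 2`, `0 ≤ U₁ < U`; a certified
ground-state floor `e₁ ≤ e(1,t′,U₁,n)`; for every torus limit `ω` of the canonical sector Gibbs states of
`hubbardTorusTT' L 1 t′ U` at `β`, a thermal energy cap `e_{Φ(1,t′,U)}(ω) ≤ e^{up}` and `−t′K₂(ω) ≤ B`; and a rational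
`c ≥ ((U₁·e^{up} − U·e₁)/(U − U₁) + B)/4`. Then `ObsThermalStiffnessSeqCeilingAtBeta t′ U n β c`.
[cite: HazraVermaRanderia2019, eqs. (2)–(4)] [cite: Ruelle1969, §3.4] -/
theorem ObsThermalStiffnessSeqCeilingAtBeta_of_energyCap_of_gsFloor {tp U n β : ℝ} (hβ : 0 < β)
    (hU : 0 ≤ U) (hn0 : 0 ≤ n) (hn2 : n < 2) {U₁ e₁ eup B : ℝ} (hU₁ : 0 ≤ U₁) (hU₁U : U₁ < U)
    (hfloor : e₁ ≤ energyDensityTT' 1 tp U₁ n)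
    (hcap : ∀ (ω : InfVolFermionState 2) (Ls : ℕ → ℕ), Tendsto Ls atTop atTop →
      ω.IsTorusLimitOfMixture (sectorGibbsCount n) (fun L => sectorGibbsWeightTT' β 1 tp U n L)
        (fun L => sectorGibbsVectorTT' 1 tp U n L) Ls →
      ω.meanEnergy (hubbardTTPrimeFermionInteraction 1 tp U) 1 ≤ eup)
    (hB : ∀ (ω : InfVolFermionState 2) (Ls : ℕ → ℕ), Tendsto Ls atTop atTop →
      ω.IsTorusLimitOfMixture (sectorGibbsCount n) (fun L => sectorGibbsWeightTT' β 1 tp U n L)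
        (fun L => sectorGibbsVectorTT' 1 tp U n L) Ls →
      -tp * ω.meanEnergy (hubbardTTPrimeFermionInteraction 0 1 0) 1 ≤ B)
    {c : ℚ} (hc : ((U₁ * eup - U * e₁) / (U - U₁) + B) / 4 ≤ ((c : ℚ) : ℝ)) :
    ObsThermalStiffnessSeqCeilingAtBeta tp U n β c :=
  ObsThermalStiffnessSeqCeilingAtBeta_of_torusLimit_kinetic_le hβ hn0 hn2.le fun ω Ls hLs hω => by
    have h := re_expect_kinBondObsTT_le_of_energyCap_of_gsFloor hU hn0 hn2 hU₁ hU₁U hfloor hω hLs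
      (hcap ω Ls hLs hω) (hB ω Ls hLs hω)
    linarith

/-- **ROUTE T-A‴ at `t′ = 0` ⇒ the leaf** (no `K₂` input): floor `e₁ ≤ e(1,0,U₁,n)`, thermal cap `e^{up}` at
`(β, U)`, `c ≥ (U₁·e^{up} − U·e₁)/(4(U − U₁))`. [cite: HazraVermaRanderia2019, eqs. (2)–(4)] [cite: Ruelle1969, §3.4] -/
theorem ObsThermalStiffnessSeqCeilingAtBeta_tp0_of_energyCap_of_gsFloor {U n β : ℝ} (hβ : 0 < β)
    (hU : 0 ≤ U) (hn0 : 0 ≤ n) (hn2 : n < 2) {U₁ e₁ eup : ℝ} (hU₁ : 0 ≤ U₁) (hU₁U : U₁ < U)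
    (hfloor : e₁ ≤ energyDensityTT' 1 0 U₁ n)
    (hcap : ∀ (ω : InfVolFermionState 2) (Ls : ℕ → ℕ), Tendsto Ls atTop atTop →
      ω.IsTorusLimitOfMixture (sectorGibbsCount n) (fun L => sectorGibbsWeightTT' β 1 0 U n L)
        (fun L => sectorGibbsVectorTT' 1 0 U n L) Ls →
      ω.meanEnergy (hubbardTTPrimeFermionInteraction 1 0 U) 1 ≤ eup)
    {c : ℚ} (hc : (U₁ * eup - U * e₁) / (U - U₁) / 4 ≤ ((c : ℚ) : ℝ)) :
    ObsThermalStiffnessSeqCeilingAtBeta 0 U n β c :=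
  ObsThermalStiffnessSeqCeilingAtBeta_of_energyCap_of_gsFloor hβ hU hn0 hn2 hU₁ hU₁U hfloor hcap
    (B := 0) (fun ω _ _ _ => by simp) (by simpa using hc)

/-- **ROUTE T-A″ ⇒ the leaf.** Floor `e₁ ≤ e(1,t′,U,n)` AT `U`; for every thermal torus limit at `β` a
double-occupancy cap `D(ω) ≤ d^{up}` and `−t′K₂(ω) ≤ B`; `c ≥ (U·d^{up} − e₁ + B)/4`.
[cite: HazraVermaRanderia2019, eqs. (2)–(4)] [cite: Ruelle1969, §3.4] -/
theorem ObsThermalStiffnessSeqCeilingAtBeta_of_doccCap_of_gsFloor {tp U n β : ℝ} (hβ : 0 < β)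
    (hU : 0 ≤ U) (hn0 : 0 ≤ n) (hn2 : n < 2) {e₁ dup B : ℝ} (hfloor : e₁ ≤ energyDensityTT' 1 tp U n)
    (hdocc : ∀ (ω : InfVolFermionState 2) (Ls : ℕ → ℕ), Tendsto Ls atTop atTop →
      ω.IsTorusLimitOfMixture (sectorGibbsCount n) (fun L => sectorGibbsWeightTT' β 1 tp U n L)
        (fun L => sectorGibbsVectorTT' 1 tp U n L) Ls →
      ω.meanEnergy (hubbardTTPrimeFermionInteraction 0 0 1) 1 ≤ dup)
    (hB : ∀ (ω : InfVolFermionState 2) (Ls : ℕ → ℕ), Tendsto Ls atTop atTop →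
      ω.IsTorusLimitOfMixture (sectorGibbsCount n) (fun L => sectorGibbsWeightTT' β 1 tp U n L)
        (fun L => sectorGibbsVectorTT' 1 tp U n L) Ls →
      -tp * ω.meanEnergy (hubbardTTPrimeFermionInteraction 0 1 0) 1 ≤ B)
    {c : ℚ} (hc : (U * dup - e₁ + B) / 4 ≤ ((c : ℚ) : ℝ)) :
    ObsThermalStiffnessSeqCeilingAtBeta tp U n β c :=
  ObsThermalStiffnessSeqCeilingAtBeta_of_torusLimit_kinetic_le hβ hn0 hn2.le fun ω Ls hLs hω => by
    have h := re_expect_kinBondObsTT_le_of_doccCap_of_gsFloor hU hn0 hn2 hfloor hω hLs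
      (hdocc ω Ls hLs hω) (hB ω Ls hLs hω)
    linarith

/-! ### §4 `T_c` closures (monotonicity-free) -/

namespace ThermalKTDictionaryAt

variable {tp U n : ℝ} {ρe : ℝ → ℝ} {Tc : ℝ}

/-- **ROUTE T-A‴ ⇒ `Tc ≤ 1/β`.** Under the inputs of
`ObsThermalStiffnessSeqCeilingAtBeta_of_energyCap_of_gsFloor` with the strict closure condition
`(π/4)·((U₁·e^{up} − U·e₁)/(U − U₁) + B)/4 < 1/β` (a rational constant is interpolated). Monotonicity-free.
[cite: HazraVermaRanderia2019, eqs. (2)–(4)] -/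
theorem le_inv_of_energyCap_of_gsFloor (hT : ThermalKTDictionaryAt tp U n ρe Tc) {β : ℝ} (hβ : 0 < β)
    (hU : 0 ≤ U) (hn0 : 0 ≤ n) (hn2 : n < 2) {U₁ e₁ eup B : ℝ} (hU₁ : 0 ≤ U₁) (hU₁U : U₁ < U)
    (hfloor : e₁ ≤ energyDensityTT' 1 tp U₁ n)
    (hcap : ∀ (ω : InfVolFermionState 2) (Ls : ℕ → ℕ), Tendsto Ls atTop atTop →
      ω.IsTorusLimitOfMixture (sectorGibbsCount n) (fun L => sectorGibbsWeightTT' β 1 tp U n L)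
        (fun L => sectorGibbsVectorTT' 1 tp U n L) Ls →
      ω.meanEnergy (hubbardTTPrimeFermionInteraction 1 tp U) 1 ≤ eup)
    (hB : ∀ (ω : InfVolFermionState 2) (Ls : ℕ → ℕ), Tendsto Ls atTop atTop →
      ω.IsTorusLimitOfMixture (sectorGibbsCount n) (fun L => sectorGibbsWeightTT' β 1 tp U n L)
        (fun L => sectorGibbsVectorTT' 1 tp U n L) Ls →
      -tp * ω.meanEnergy (hubbardTTPrimeFermionInteraction 0 1 0) 1 ≤ B)
    (hlt : Real.pi / 4 * (((U₁ * eup - U * e₁) / (U - U₁) + B) / 4) < 1 / β) : Tc ≤ 1 / β := by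
  have hπ : 0 < Real.pi / 4 := by positivity
  have hκ : ((U₁ * eup - U * e₁) / (U - U₁) + B) / 4 < (1 / β) / (Real.pi / 4) := by
    rw [lt_div_iff₀ hπ]; linarith
  obtain ⟨c, hc1, hc2⟩ := exists_rat_btwn hκ
  refine hT.le_inv_of_leafAtBeta hβ
    (ObsThermalStiffnessSeqCeilingAtBeta_of_energyCap_of_gsFloor hβ hU hn0 hn2 hU₁ hU₁U hfloor hcap hB hc1.le) ?_
  have hc3 := (lt_div_iff₀ hπ).1 hc2
  linarith

/-- **ROUTE T-A‴ at `(8, ⅞, 0)`, any `β`** («`T_KT ≤ 1/β`», monotonicity-free): a certified ground-state floor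
`e₁ ≤ e(1, 0, U₁, ⅞)` at some `0 ≤ U₁ < 8`, a certified thermal cap `e_{Φ(1,0,8)}(ω) ≤ e^{up}` on every torus
limit of the canonical sector Gibbs states at `β`, and `(π/16)·(U₁·e^{up} − 8·e₁)/(8 − U₁) < 1/β`, give
`Tc ≤ 1/β`. (Dial: the row closed is `T₁ = 1/β` for the SMALLEST `β` at which the cap is certified and the
inequality holds; an energy cap at `β` is a cap at every `β' ≥ β`.) [cite: HazraVermaRanderia2019, eqs. (2)–(4)] -/
theorem le_inv_of_energyCap_of_gsFloor_n7o8_tp0 (hT : ThermalKTDictionaryAt 0 8 (7 / 8) ρe Tc) {β : ℝ}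
    (hβ : 0 < β) {U₁ e₁ eup : ℝ} (hU₁ : 0 ≤ U₁) (hU₁U : U₁ < 8)
    (hfloor : e₁ ≤ energyDensityTT' 1 0 U₁ (7 / 8))
    (hcap : ∀ (ω : InfVolFermionState 2) (Ls : ℕ → ℕ), Tendsto Ls atTop atTop →
      ω.IsTorusLimitOfMixture (sectorGibbsCount (7 / 8)) (fun L => sectorGibbsWeightTT' β 1 0 8 (7 / 8) L)
        (fun L => sectorGibbsVectorTT' 1 0 8 (7 / 8) L) Ls →
      ω.meanEnergy (hubbardTTPrimeFermionInteraction 1 0 8) 1 ≤ eup)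
    (hlt : Real.pi / 16 * ((U₁ * eup - 8 * e₁) / (8 - U₁)) < 1 / β) : Tc ≤ 1 / β :=
  hT.le_inv_of_energyCap_of_gsFloor hβ (by norm_num) (by norm_num) (by norm_num) hU₁ hU₁U hfloor hcap
    (B := 0) (fun ω _ _ _ => by simp) (by linarith)

/-- **ROUTE T-A″ ⇒ `Tc ≤ 1/β`.** Floor `e₁ ≤ e(1,t′,U,n)` at `U`, thermal caps `D(ω) ≤ d^{up}` and
`−t′K₂(ω) ≤ B` on every thermal torus limit at `β`, and `(π/16)·(U·d^{up} − e₁ + B) < 1/β`. Monotonicity-free.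
[cite: HazraVermaRanderia2019, eqs. (2)–(4)] -/
theorem le_inv_of_doccCap_of_gsFloor (hT : ThermalKTDictionaryAt tp U n ρe Tc) {β : ℝ} (hβ : 0 < β)
    (hU : 0 ≤ U) (hn0 : 0 ≤ n) (hn2 : n < 2) {e₁ dup B : ℝ} (hfloor : e₁ ≤ energyDensityTT' 1 tp U n)
    (hdocc : ∀ (ω : InfVolFermionState 2) (Ls : ℕ → ℕ), Tendsto Ls atTop atTop →
      ω.IsTorusLimitOfMixture (sectorGibbsCount n) (fun L => sectorGibbsWeightTT' β 1 tp U n L)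
        (fun L => sectorGibbsVectorTT' 1 tp U n L) Ls →
      ω.meanEnergy (hubbardTTPrimeFermionInteraction 0 0 1) 1 ≤ dup)
    (hB : ∀ (ω : InfVolFermionState 2) (Ls : ℕ → ℕ), Tendsto Ls atTop atTop →
      ω.IsTorusLimitOfMixture (sectorGibbsCount n) (fun L => sectorGibbsWeightTT' β 1 tp U n L)
        (fun L => sectorGibbsVectorTT' 1 tp U n L) Ls →
      -tp * ω.meanEnergy (hubbardTTPrimeFermionInteraction 0 1 0) 1 ≤ B)
    (hlt : Real.pi / 16 * (U * dup - e₁ + B) < 1 / β) : Tc ≤ 1 / β := by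
  have hπ : 0 < Real.pi / 4 := by positivity
  have hκ : (U * dup - e₁ + B) / 4 < (1 / β) / (Real.pi / 4) := by
    rw [lt_div_iff₀ hπ]; linarith
  obtain ⟨c, hc1, hc2⟩ := exists_rat_btwn hκ
  refine hT.le_inv_of_leafAtBeta hβ
    (ObsThermalStiffnessSeqCeilingAtBeta_of_doccCap_of_gsFloor hβ hU hn0 hn2 hfloor hdocc hB hc1.le) ?_
  have hc3 := (lt_div_iff₀ hπ).1 hc2
  linarith

end ThermalKTDictionaryAt

/-! ### §5 (appended) The mixed form: a ground-state floor at ANY coupling `U₁ ≥ 0` with a thermal double-occupancy cap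

The variational inequality holds at every coupling `U₁ ≥ 0` (below OR above `U`), so a floor `e₁ ≤ e(1,t′,U₁,n)` and a
thermal cap `D(ω) ≤ d^{up}` give `−(K₁ + t′K₂) ≤ U₁·d^{up} − e₁` — the joint LP of (energy cap, docc cap, floors) is won
by this vertex whenever `d^{up} < (e^{up} − e₁)/(U − U₁)`. Sizing at `(8, ⅞, 0)` with CERTIFIED #507 (`e(1,0,2,⅞) ≥ −1.3123239853`,
tree node `cert_r507_bs_GU2n7o8tp0_A4pU2_uprime`): `κ = 2·d^{up} + 1.3123240`, so ONE thermal docc cap `d^{up}(β) < 0.1396127`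
issued at `β·t = 3.2` closes «`T_KT ≤ 0.3125·t`» monotonicity-free (KT-THERMAL-INTERFACE §2d). -/

/-- **Floor at any coupling + thermal docc cap, state by state.** `U ≥ 0`, `0 ≤ n < 2`, `U₁ ≥ 0` (any side of `U`). For a
torus limit `ω` of the canonical sector Gibbs states of `hubbardTorusTT' L 1 t′ U` at `β`: `e₁ ≤ e(1,t′,U₁,n)`, `D(ω) ≤ d^{up}`
and `−t′·K₂(ω) ≤ B` give `Re ω(k₀^{tt′}) ≤ ½·(U₁·d^{up} − e₁ + B)`. [cite: Ruelle1969, §3.4] [cite: HazraVermaRanderia2019, eq. (4)] -/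
theorem re_expect_kinBondObsTT_le_of_doccCap_of_gsFloor_at {tp U n β : ℝ} (hn0 : 0 ≤ n) (hn2 : n < 2)
    {U₁ e₁ dup B : ℝ} (hU₁ : 0 ≤ U₁) (hfloor : e₁ ≤ energyDensityTT' 1 tp U₁ n)
    {ω : InfVolFermionState 2} {Ls : ℕ → ℕ}
    (h : ω.IsTorusLimitOfMixture (sectorGibbsCount n) (fun L => sectorGibbsWeightTT' β 1 tp U n L)
      (fun L => sectorGibbsVectorTT' 1 tp U n L) Ls) (hLs : Tendsto Ls atTop atTop)
    (hdocc : ω.meanEnergy (hubbardTTPrimeFermionInteraction 0 0 1) 1 ≤ dup)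
    (hB : -tp * ω.meanEnergy (hubbardTTPrimeFermionInteraction 0 1 0) 1 ≤ B) :
    (ω.expect (box 2 1) (kinBondObsTT tp)).re ≤ (U₁ * dup - e₁ + B) / 2 := by
  have hvar := h.energyDensityTT'_le_meanEnergy_add_slopes 1 tp U hn0 hn2 hLs
    (fun L i => sectorGibbsWeightTT'_nonneg β 1 tp U n L i)
    (fun L => sum_sectorGibbsWeightTT' β 1 tp U hn0 hn2.le L)
    (fun L i => isNParticle_sectorGibbsVectorTT' 1 tp U n L i)
    (fun L i => star_sectorGibbsVectorTT'_dotProduct_self 1 tp U n L i) tp hU₁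
  rw [← h.meanEnergy_onSite_eq_re_expect_docc hLs, sub_self, zero_mul, add_zero] at hvar
  have hco := InfVolFermionState.meanEnergy_hubbardTTPrime_eq_coords ω 1 tp U
  rw [re_expect_kinBondObsTT_eq_of_isD4Invariant h.isTranslationInvariant
    (h.isD4Invariant_of_sectorGibbs 1 tp U n β hLs) tp]
  have hUd := mul_le_mul_of_nonneg_left hdocc hU₁
  rw [hco] at hvar
  linarith

/-- **Mixed form ⇒ the single-temperature leaf.** Floor `e₁ ≤ e(1,t′,U₁,n)` at any `U₁ ≥ 0`; for every thermal torus limit at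
`(β, U)` a docc cap `D(ω) ≤ d^{up}` and `−t′K₂(ω) ≤ B`; `c ≥ (U₁·d^{up} − e₁ + B)/4`.
[cite: HazraVermaRanderia2019, eqs. (2)–(4)] [cite: Ruelle1969, §3.4] -/
theorem ObsThermalStiffnessSeqCeilingAtBeta_of_doccCap_of_gsFloor_at {tp U n β : ℝ} (hβ : 0 < β)
    (hn0 : 0 ≤ n) (hn2 : n < 2) {U₁ e₁ dup B : ℝ} (hU₁ : 0 ≤ U₁) (hfloor : e₁ ≤ energyDensityTT' 1 tp U₁ n)
    (hdocc : ∀ (ω : InfVolFermionState 2) (Ls : ℕ → ℕ), Tendsto Ls atTop atTop →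
      ω.IsTorusLimitOfMixture (sectorGibbsCount n) (fun L => sectorGibbsWeightTT' β 1 tp U n L)
        (fun L => sectorGibbsVectorTT' 1 tp U n L) Ls →
      ω.meanEnergy (hubbardTTPrimeFermionInteraction 0 0 1) 1 ≤ dup)
    (hB : ∀ (ω : InfVolFermionState 2) (Ls : ℕ → ℕ), Tendsto Ls atTop atTop →
      ω.IsTorusLimitOfMixture (sectorGibbsCount n) (fun L => sectorGibbsWeightTT' β 1 tp U n L)
        (fun L => sectorGibbsVectorTT' 1 tp U n L) Ls →
      -tp * ω.meanEnergy (hubbardTTPrimeFermionInteraction 0 1 0) 1 ≤ B)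
    {c : ℚ} (hc : (U₁ * dup - e₁ + B) / 4 ≤ ((c : ℚ) : ℝ)) :
    ObsThermalStiffnessSeqCeilingAtBeta tp U n β c :=
  ObsThermalStiffnessSeqCeilingAtBeta_of_torusLimit_kinetic_le hβ hn0 hn2.le fun ω Ls hLs hω => by
    have h := re_expect_kinBondObsTT_le_of_doccCap_of_gsFloor_at hn0 hn2 hU₁ hfloor hω hLs
      (hdocc ω Ls hLs hω) (hB ω Ls hLs hω)
    linarith

namespace ThermalKTDictionaryAt

variable {tp U n : ℝ} {ρe : ℝ → ℝ} {Tc : ℝ}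

/-- **Mixed form ⇒ `Tc ≤ 1/β`.** Floor at any `U₁ ≥ 0`, thermal caps `D(ω) ≤ d^{up}`, `−t′K₂(ω) ≤ B` at `(β, U)`, and
`(π/16)·(U₁·d^{up} − e₁ + B) < 1/β`. Monotonicity-free. [cite: HazraVermaRanderia2019, eqs. (2)–(4)] -/
theorem le_inv_of_doccCap_of_gsFloor_at (hT : ThermalKTDictionaryAt tp U n ρe Tc) {β : ℝ} (hβ : 0 < β)
    (hn0 : 0 ≤ n) (hn2 : n < 2) {U₁ e₁ dup B : ℝ} (hU₁ : 0 ≤ U₁) (hfloor : e₁ ≤ energyDensityTT' 1 tp U₁ n)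
    (hdocc : ∀ (ω : InfVolFermionState 2) (Ls : ℕ → ℕ), Tendsto Ls atTop atTop →
      ω.IsTorusLimitOfMixture (sectorGibbsCount n) (fun L => sectorGibbsWeightTT' β 1 tp U n L)
        (fun L => sectorGibbsVectorTT' 1 tp U n L) Ls →
      ω.meanEnergy (hubbardTTPrimeFermionInteraction 0 0 1) 1 ≤ dup)
    (hB : ∀ (ω : InfVolFermionState 2) (Ls : ℕ → ℕ), Tendsto Ls atTop atTop →
      ω.IsTorusLimitOfMixture (sectorGibbsCount n) (fun L => sectorGibbsWeightTT' β 1 tp U n L)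
        (fun L => sectorGibbsVectorTT' 1 tp U n L) Ls →
      -tp * ω.meanEnergy (hubbardTTPrimeFermionInteraction 0 1 0) 1 ≤ B)
    (hlt : Real.pi / 16 * (U₁ * dup - e₁ + B) < 1 / β) : Tc ≤ 1 / β := by
  have hπ : 0 < Real.pi / 4 := by positivity
  have hκ : (U₁ * dup - e₁ + B) / 4 < (1 / β) / (Real.pi / 4) := by
    rw [lt_div_iff₀ hπ]; linarith
  obtain ⟨c, hc1, hc2⟩ := exists_rat_btwn hκ
  refine hT.le_inv_of_leafAtBeta hβ
    (ObsThermalStiffnessSeqCeilingAtBeta_of_doccCap_of_gsFloor_at hβ hn0 hn2 hU₁ hfloor hdocc hB hc1.le) ?_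
  have hc3 := (lt_div_iff₀ hπ).1 hc2
  linarith

/-- **Mixed form at `(8, ⅞, 0)`, docc cap in WORD shape.** A certified ground-state floor `e₁ ≤ e(1,0,U₁,⅞)` at some
`U₁ ≥ 0` (e.g. CERTIFIED #507 at `U₁ = 2`), a certified thermal cap `Re ω(n_{0↑}n_{0↓}) ≤ d^{up}` on every torus limit of the
canonical sector Gibbs states at `β`, and `(π/16)·(U₁·d^{up} − e₁) < 1/β` give `Tc ≤ 1/β`. With #507: `d^{up} < 0.1396127` at
`β·t = 3.2` closes «`T_KT ≤ 0.3125·t`». [cite: HazraVermaRanderia2019, eqs. (2)–(4)] -/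
theorem le_inv_of_doccWordCap_of_gsFloor_at_n7o8_tp0 (hT : ThermalKTDictionaryAt 0 8 (7 / 8) ρe Tc) {β : ℝ}
    (hβ : 0 < β) {U₁ e₁ dup : ℝ} (hU₁ : 0 ≤ U₁) (hfloor : e₁ ≤ energyDensityTT' 1 0 U₁ (7 / 8))
    (hdocc : ∀ (ω : InfVolFermionState 2) (Ls : ℕ → ℕ), Tendsto Ls atTop atTop →
      ω.IsTorusLimitOfMixture (sectorGibbsCount (7 / 8)) (fun L => sectorGibbsWeightTT' β 1 0 8 (7 / 8) L)
        (fun L => sectorGibbsVectorTT' 1 0 8 (7 / 8) L) Ls →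
      (ω.expect ({0} : Finset (Site 2))
        (nAt 0 (Finset.mem_singleton_self 0) 0 * nAt 0 (Finset.mem_singleton_self 0) 1)).re ≤ dup)
    (hlt : Real.pi / 16 * (U₁ * dup - e₁) < 1 / β) : Tc ≤ 1 / β :=
  hT.le_inv_of_doccCap_of_gsFloor_at hβ (by norm_num) (by norm_num) hU₁ hfloor
    (fun ω Ls hLs hω => by rw [hω.meanEnergy_onSite_eq_re_expect_docc hLs]; exact hdocc ω Ls hLs hω)
    (B := 0) (fun ω _ _ _ => by simp) (by linarith)

end ThermalKTDictionaryAt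

end Summit.Ventures.CertifiedManyBodySolver.Observables

end
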